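import Mathlib
import Summits.NavierStokesRegularity.NavierStokesRegularity.Theorems.FilamentSkeletonRssStadiumPlateauConcrete
import Summits.NavierStokesRegularity.NavierStokesRegularity.Theorems.FilamentSkeletonRssStadiumConnectorConcrete
import Summits.NavierStokesRegularity.NavierStokesRegularity.Theorems.FilamentSkeletonRssStadiumOwnFarPiece

/-!
# Bound of the continued OWN-filament field on the output stadium (`TangentSkeletonNearStraightL`, stmt-NavierStokesRegularity-23320, registered stub
# `stub_stripPropagation` — blueprint item R6′ for `k = j`, assembled)

Concrete retype geometry (`16h ≤ hs`, `S₁₆`, `P = L + 8h`, ratio 8, `M = 2`, `0 ≤ Rb ≤ 1/2`).  For every `z ∈ S₁₆` the own-filament continued field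
`U(z) = Far(z) + [Plateau(z) − i•ConnR(z) + i•ConnL(z)]` (Theorems.StadiumOwnContourHolo) satisfies
  `‖U(z)‖ ≤ 360π/((7/16)·3h) + 4·2·(2/(7h))·(1/3 + log(2P√A₁/μ))/A₁^{3/2} + 2·h·((7h)²C)^{−3/2}·8(2L + 11h)`
(`own_contour_norm_le`) — Theorems.StadiumOwnFarPiece.ownFarPiece_norm_le + StadiumPlateauConcrete + StadiumConnectorConcrete.  With `h = cs√Γ/16`,
`L = Rb√(Γ log Γ)`: `O(log Γ/√Γ)` per unit circulation, `O(√Γ log Γ)` after `Γγ/4π`.  HONEST FRAMING: bookkeeping for a HYPOTHETICAL filament skeleton on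
the NEGATIVE side of a MODEL route; nothing here bears on Navier–Stokes regularity or blow-up.  `--supports stmt-NavierStokesRegularity-23320`.
-/

set_option linter.dupNamespace false

noncomputable section

namespace Summit.NavierStokesRegularity.NavierStokesRegularity.Theorems.StadiumOwnContourBound

open Set Metric MeasureTheory Complex
open scoped InnerProductSpace Matrix
open Summit.NavierStokesRegularity.NavierStokesRegularity.Theorems.StadiumPlateauConcrete
open Summit.NavierStokesRegularity.NavierStokesRegularity.Theorems.StadiumConnectorConcrete
open Summit.NavierStokesRegularity.NavierStokesRegularity.Theorems.StadiumOwnFarPiece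

/-- **Bound of the own-filament continued field on `S₁₆`.**  See the module docstring. [folklore] -/
theorem own_contour_norm_le {hs L cc Rb h κ Λ : ℝ} {F : ℂ → (Fin 3 → ℂ)} {G : ℂ → ℂ} {A : ℝ → ℝ}
    (hF : DifferentiableOn ℂ F {z : ℂ | |z.im| < hs ∧ |z.re - cc| < L + hs})
    (hunit : ∀ w ∈ {z : ℂ | |z.im| < hs ∧ |z.re - cc| < L + hs}, ∑ i, (deriv F w i) ^ 2 = 1)
    (hM : ∀ z ∈ {z : ℂ | |z.im| < hs ∧ |z.re - cc| < L + hs}, ‖deriv F z‖ ≤ 2)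
    {X : ℝ → EuclideanSpace ℝ (Fin 3)} (hX : Differentiable ℝ X) (hXu : ∀ τ, ‖deriv X τ‖ = 1)
    (hRb0 : 0 ≤ Rb) (hRb : Rb ≤ 1 / 2) (hosc : ∀ τ σ, ‖deriv X τ - deriv X σ‖ ≤ Rb)
    (hFX : ∀ r : ℝ, (r : ℂ) ∈ {z : ℂ | |z.im| < hs ∧ |z.re - cc| < L + hs} →
      F r = fun i => ((⟪X r, EuclideanSpace.single i (1:ℝ)⟫_ℝ : ℝ) : ℂ))
    (hGre : ∀ w ∈ {z : ℂ | |z.im| < hs ∧ |z.re - cc| < L + hs}, Λ⁻¹ / 2 ≤ (G w).re)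
    (hA : ∀ σ, 0 ≤ A σ)
    (hκ : 0 < κ) (hΛ : 0 < Λ) (hh : 0 < h) (h16 : 16 * h ≤ hs) (hL : 0 ≤ L) {z : ℂ} (hz : |z.im| < h ∧ |z.re - cc| < L + h)
    (hR : √(κ / (2 * Λ)) / √(1 - (Rb + 2 * (√3 * (2 * 2 * (Real.log ((8:ℝ) / (8 - 1)) - 1 / 8)))) ^ 2 / 2) ≤
      (cc + (L + 8 * h)) - (cc - (L + 8 * h))) :
    let K : ℂ → (Fin 3 → ℂ) := fun ζ => (((∑ i, (F z i - F ζ i) ^ 2) + (κ : ℂ) * G ζ) ^ ((3:ℂ) / 2))⁻¹ •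
        (deriv F ζ ⨯₃ (fun i => F z i - F ζ i))
    ‖(∫ σ in {σ : ℝ | L + 8 * h ≤ |σ - cc|},
        (((∑ i, (F z i - ((X σ i : ℝ) : ℂ)) ^ 2) + ((κ * A σ : ℝ) : ℂ)) ^ ((3:ℂ) / 2))⁻¹ •
          ((fun i => ((deriv X σ i : ℝ) : ℂ)) ⨯₃ (fun i => F z i - ((X σ i : ℝ) : ℂ)))) +
      ((∫ σ in (cc - (L + 8 * h))..(cc + (L + 8 * h)), K ((σ : ℂ) + (z.im : ℂ) * I)) -
        I • (∫ s in (0:ℝ)..z.im, K (((cc + (L + 8 * h) : ℝ) : ℂ) + (s : ℂ) * I)) +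
        I • (∫ s in (0:ℝ)..z.im, K (((cc - (L + 8 * h) : ℝ) : ℂ) + (s : ℂ) * I)))‖ ≤
      5 * 72 * (Real.pi / ((7 / 16) * (3 * h))) +
      4 * (2 * (2 / (7 * h))) * ((1/3 + Real.log (((cc + (L + 8 * h)) - (cc - (L + 8 * h))) *
          √(1 - (Rb + 2 * (√3 * (2 * 2 * (Real.log ((8:ℝ) / (8 - 1)) - 1 / 8)))) ^ 2 / 2) / √(κ / (2 * Λ)))) /
        (1 - (Rb + 2 * (√3 * (2 * 2 * (Real.log ((8:ℝ) / (8 - 1)) - 1 / 8)))) ^ 2 / 2) ^ (3/2 : ℝ)) +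
      2 * (h * (((7 * h) ^ 2 * ((1 - (2 / 7 : ℝ) ^ 2) * (1 - (Rb + 2 * (√3 * (2 * 2 * (Real.log ((8:ℝ) / (8 - 1)) - 1 / 8)))) ^ 2 / 2) -
        2 * (2 / 7 : ℝ) * (2 * (√3 * (2 * Real.log ((8:ℝ) / (8 - 1)))) * (Rb + 2 * (√3 * (2 * 2 * (Real.log ((8:ℝ) / (8 - 1)) - 1 / 8))))))) ^ (-(3/2 : ℝ)) *
        (2 * 2 ^ 2 * (2 * L + 11 * h)))) := by
  intro K
  have hosc2 : ∀ τ σ, ‖deriv X τ - deriv X σ‖ ≤ 1 / 2 := fun τ σ => (hosc τ σ).trans hRb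
  have hfar := ownFarPiece_norm_le (hs' := h) hF hM hX hXu hosc2 hFX hA hκ.le hh (by linarith) (z := z) hz
  have hpl := plateau_norm_le_concrete hF hunit hM hX hXu hRb0 hRb hosc hFX hGre hκ hΛ hh h16 hL hz hR
  have hPb : |cc + (L + 8 * h) - cc| = L + 8 * h := by rw [show cc + (L + 8 * h) - cc = L + 8 * h by ring, abs_of_pos (by linarith)]
  have hPa : |cc - (L + 8 * h) - cc| = L + 8 * h := by
    rw [show cc - (L + 8 * h) - cc = -(L + 8 * h) by ring, abs_neg, abs_of_pos (by linarith)]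
  have hcR := connector_norm_le_concrete hF hunit hM hX hXu hRb0 hRb hosc hFX hGre hκ hΛ hh h16 hPb hz
  have hcL := connector_norm_le_concrete hF hunit hM hX hXu hRb0 hRb hosc hFX hGre hκ hΛ hh h16 hPa hz
  have hI : ∀ v : Fin 3 → ℂ, ‖I • v‖ = ‖v‖ := fun v => by rw [norm_smul, Complex.norm_I, one_mul]
  calc _ ≤ ‖∫ σ in {σ : ℝ | L + 8 * h ≤ |σ - cc|},
        (((∑ i, (F z i - ((X σ i : ℝ) : ℂ)) ^ 2) + ((κ * A σ : ℝ) : ℂ)) ^ ((3:ℂ) / 2))⁻¹ •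
          ((fun i => ((deriv X σ i : ℝ) : ℂ)) ⨯₃ (fun i => F z i - ((X σ i : ℝ) : ℂ)))‖ +
      ‖(∫ σ in (cc - (L + 8 * h))..(cc + (L + 8 * h)), K ((σ : ℂ) + (z.im : ℂ) * I)) -
        I • (∫ s in (0:ℝ)..z.im, K (((cc + (L + 8 * h) : ℝ) : ℂ) + (s : ℂ) * I)) +
        I • (∫ s in (0:ℝ)..z.im, K (((cc - (L + 8 * h) : ℝ) : ℂ) + (s : ℂ) * I))‖ := norm_add_le _ _
    _ ≤ _ := by
        have h1 := norm_add_le ((∫ σ in (cc - (L + 8 * h))..(cc + (L + 8 * h)), K ((σ : ℂ) + (z.im : ℂ) * I)) -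
            I • (∫ s in (0:ℝ)..z.im, K (((cc + (L + 8 * h) : ℝ) : ℂ) + (s : ℂ) * I)))
          (I • (∫ s in (0:ℝ)..z.im, K (((cc - (L + 8 * h) : ℝ) : ℂ) + (s : ℂ) * I)))
        have h2 := norm_sub_le (∫ σ in (cc - (L + 8 * h))..(cc + (L + 8 * h)), K ((σ : ℂ) + (z.im : ℂ) * I))
          (I • (∫ s in (0:ℝ)..z.im, K (((cc + (L + 8 * h) : ℝ) : ℂ) + (s : ℂ) * I)))
        rw [hI] at h1 h2
        linarith [hfar, hpl, hcR, hcL, h1, h2]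

end Summit.NavierStokesRegularity.NavierStokesRegularity.Theorems.StadiumOwnContourBound

end
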